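import Summits.CriticalPhenomena.Ising3DConformalLimit.Theorems.PlantedPinningMoebiusLimitExistsLocalWard
import Summits.CriticalPhenomena.Ising3DConformalLimit.Theorems.HyperoctahedralRPInversionUpgradeNormalisedOSLayer
import Summits.CriticalPhenomena.Ising3DConformalLimit.Theorems.PlantedPinningMoebiusLimitExistsDefectRotate
import Summits.CriticalPhenomena.Ising3DConformalLimit.Theorems.PlantedPinningMoebiusLimitExistsDefectPerm
import Summits.CriticalPhenomena.Ising3DConformalLimit.Theorems.PlantedPinningMoebiusLimitExistsRotationGenerator
import Summits.CriticalPhenomena.Ising3DConformalLimit.Theorems.PlantedPinningMoebiusLimitExistsDefectTranslate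
import Summits.CriticalPhenomena.Ising3DConformalLimit.Theorems.PlantedPinningMoebiusLimitExistsDefectDilate
import Mathlib.Analysis.InnerProductSpace.Projection.Reflection
import Mathlib.Analysis.SpecialFunctions.Pow.Deriv
import Literature.Probability.LatticeModels.SCTWardIdentity
import HarnessLib

/-!
# Symmetry-protected zeros of the special-conformal Ward defect
(crux `MoebiusLimitExists`, stmt-CriticalPhenomena-1344, line `Sketch` v16, lead prover-line-stmt-CriticalPhenomena-1344-c19-0;
THEOREM-ONLY, `--supports stmt-CriticalPhenomena-1344`)

The residual of the crux (skeletons v11–v16) is the single-generator special-conformal Ward identity of the Ising₃ scaling limit,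
i.e. the vanishing of the POINTWISE DEFECT of a level `F = S n`,

  `E_b(F)(x) := DF(x)[(‖xᵢ‖² b − 2⟪b,xᵢ⟫ xᵢ)ᵢ] − 2Δ (Σᵢ ⟪b,xᵢ⟫) F(x)`      (generator `b ∈ ℝ³`, weight `Δ`).

This file records, with proofs, WHICH PART OF THAT IDENTITY IS AUTOMATIC for every `O(3) × S_n`-invariant, translation-invariant,
scale-covariant `C¹` level — in particular for every level of every Euclidean scale-covariant Ising₃ limit, with no Ward identity assumed:

* §A (one level, pure analysis; the registered stubs Z1 `stub_defect_rotate`, Z2 `stub_defect_perm`, Z3 `stub_fderiv_rotationGenerator`,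
  Z4 `stub_defect_translate`, Z5 `stub_defect_dilate` of skeleton v16 are imported): `E_{−b} = −E_b`; the Euler identity
  `DF(x)[x] = −nΔ F(x)` of a scale-covariant level (`fderiv_self_of_scaleCovariant`); **FREE ZEROS**: `E_b(F)(x) = 0` for EVERY `b` at
  every configuration CENTRALLY SYMMETRIC about the origin (`x ∘ σ = −x`; `O(3)` and relabelling invariance only, any `Δ`, no
  differentiability), and `E_v(F)(x) = 0` at every configuration lying in the plane `v^⊥` (reflection in `v^⊥`);
* §B (Ising₃ limits): the defect of every level of a normalised non-degenerate Euclidean scale-covariant limit of `criticalCorr 3` is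
  TRANSLATION INVARIANT and DILATION HOMOGENEOUS (`limit_defect_translate`, `limit_defect_dilate`: the conformal-algebra relations
  `[P_a,K_b] = 2δ_{ab}D − 2M_{ab}`, `[D,K_b] = K_b` read on the defect), hence vanishes for every `b` at every configuration centrally
  symmetric about ANY centre (`limit_defect_eq_zero_of_centrallySymmetric`: all parallelograms at `n = 4`, all centrally symmetric
  `2k`-gons, prisms, …) and, for the generator `v`, at every configuration in ANY plane perpendicular to `v`
  (`limit_defect_eq_zero_of_coplanar`); for the registered generator `e₀` of 7⁗: at every configuration with all heights equal.
  Consequently the order-`0` Taylor coefficient of the registered residual 7⁗_jet (`stub_interiorWardK1Jet`) is FREE at such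
  configurations (`limit_jetK1_order_zero_of_horizontal`); the conformal content of the Ising₃ `σ`-sector sits in the TRANSVERSAL Taylor
  coefficients — by translation/dilation invariance of the defect, in `3n − 4` of the `3n` directions, and only off the two loci above.

References: Di Francesco–Mathieu–Sénéchal 1997 §4.1 (4.18)–(4.19), §4.3.1 (4.51)–(4.54) [FrancescoMathieuSenechal1997];
Glimm–Jaffe 1987 §6.1 [GlimmJaffe1987].  No definitions, no `sorry`.
-/

noncomputable section

namespace Summit.CriticalPhenomena.Ising3DConformalLimit.MoebiusLimitExistsDefectSymmetry

open Filter Topology Set Function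
open Literature.Probability.LatticeModels
open Summit.CriticalPhenomena.Ising3DConformalLimit.MoebiusLimitExistsSketchV16
  (stub_defect_rotate stub_defect_perm stub_fderiv_rotationGenerator stub_defect_translate stub_defect_dilate)
open Summit.CriticalPhenomena.Ising3DConformalLimit.MoebiusLimitExistsLocalWard (analyticOnNhd_limit)
open Summit.CriticalPhenomena.Ising3DConformalLimit.Cruxes.InversionUpgradeNormalised.FreeEndpointGaussianClosure
  (isPermutationSymmetric_of_limit)

/-! ## A. One level `F : (ℝ³)ⁿ → ℝ`: sign, Euler identity, and the FREE ZEROS of the defect -/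

/-- **`E_{−b}(F) = −E_b(F)`**: the defect is odd (indeed linear) in the generator. [folklore] -/
theorem defect_neg_left (n : ℕ) (F : (Fin n → (EuclideanSpace ℝ (Fin 3))) → ℝ) (Δ : ℝ) (b : (EuclideanSpace ℝ (Fin 3))) (x : Fin n → (EuclideanSpace ℝ (Fin 3))) :
    fderiv ℝ F x (fun i => ‖x i‖ ^ 2 • (-b) - (2 * inner ℝ (-b) (x i)) • x i) - 2 * Δ * (∑ i, inner ℝ (-b) (x i)) * F x =
      -(fderiv ℝ F x (fun i => ‖x i‖ ^ 2 • b - (2 * inner ℝ b (x i)) • x i) - 2 * Δ * (∑ i, inner ℝ b (x i)) * F x) := by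
  have hv : (fun i => ‖x i‖ ^ 2 • (-b) - (2 * inner ℝ (-b) (x i)) • x i) =
      -(fun i => ‖x i‖ ^ 2 • b - (2 * inner ℝ b (x i)) • x i) := by
    funext i
    simp only [Pi.neg_apply, inner_neg_left, smul_neg, mul_neg, neg_smul]
    abel
  rw [hv, map_neg]
  simp only [inner_neg_left, Finset.sum_neg_distrib]
  ring

/-- **The Euler identity of a scale-covariant level**: if `F(t y) = t^{−nΔ} F(y)` for `t > 0` and `F` is differentiable at `x`, then
`DF(x)[x] = −nΔ F(x)` (differentiate `t ↦ F(t x) = t^{−nΔ} F(x)` at `t = 1`). [cite: FrancescoMathieuSenechal1997, §4.1 (4.18)–(4.19)] -/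
theorem fderiv_self_of_scaleCovariant (n : ℕ) (F : (Fin n → (EuclideanSpace ℝ (Fin 3))) → ℝ) (Δ : ℝ) (x : Fin n → (EuclideanSpace ℝ (Fin 3))) (hF : DifferentiableAt ℝ F x)
    (hsc : ∀ t : ℝ, 0 < t → ∀ y : Fin n → (EuclideanSpace ℝ (Fin 3)), F (fun i => t • y i) = t ^ (-(n : ℝ) * Δ) * F y) :
    fderiv ℝ F x x = -(n * Δ) * F x := by
  -- the curve `t ↦ t • x` through `x` at `t = 1`
  have hγ : HasDerivAt (fun t : ℝ => t • x) x 1 := by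
    simpa using (hasDerivAt_id (1:ℝ)).smul_const x
  have h1 : HasDerivAt (fun t : ℝ => F (t • x)) (fderiv ℝ F x x) 1 :=
    hF.hasFDerivAt.comp_hasDerivAt_of_eq 1 hγ (one_smul ℝ x).symm
  -- along the curve `F` is the power function
  have h2 : HasDerivAt (fun t : ℝ => t ^ (-(n : ℝ) * Δ) * F x) (-(n : ℝ) * Δ * F x) 1 := by
    have h := (Real.hasDerivAt_rpow_const (x := (1:ℝ)) (p := -(n : ℝ) * Δ) (Or.inl one_ne_zero)).mul_const (F x)
    simpa using h
  have heq : (fun t : ℝ => F (t • x)) =ᶠ[𝓝 1] fun t => t ^ (-(n : ℝ) * Δ) * F x := by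
    filter_upwards [Ioi_mem_nhds (zero_lt_one' ℝ)] with t ht
    exact hsc t ht x
  have h3 := h1.unique (h2.congr_of_eventuallyEq heq)
  rw [h3]
  ring

/-- **FREE ZEROS, I — central symmetry.**  For a level invariant under the diagonal action of `O(3)` and under relabelling, the
defect vanishes for EVERY generator at every configuration centrally symmetric about the origin (`x (σ i) = −x i` for a relabelling
`σ`): `E_{−b}(−x) = E_b(x)` (Z1 with `R = −1`), `−x = x ∘ σ` and `E_{−b}(x ∘ σ) = E_{−b}(x)` (Z2), `E_{−b} = −E_b`.  Any weight; no
differentiability needed. [cite: FrancescoMathieuSenechal1997, §4.1 (4.18)–(4.19)] -/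
theorem defect_eq_zero_of_centrallySymmetric (n : ℕ) (F : (Fin n → (EuclideanSpace ℝ (Fin 3))) → ℝ) (Δ : ℝ)
    (hrot : ∀ (R : (EuclideanSpace ℝ (Fin 3)) ≃ₗᵢ[ℝ] (EuclideanSpace ℝ (Fin 3))) (y : Fin n → (EuclideanSpace ℝ (Fin 3))), F (fun i => R (y i)) = F y)
    (hperm : ∀ (σ : Equiv.Perm (Fin n)) (y : Fin n → (EuclideanSpace ℝ (Fin 3))), F (y ∘ σ) = F y)
    (x : Fin n → (EuclideanSpace ℝ (Fin 3))) (σ : Equiv.Perm (Fin n)) (hx : ∀ i, x (σ i) = -x i) (b : (EuclideanSpace ℝ (Fin 3))) :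
    fderiv ℝ F x (fun i => ‖x i‖ ^ 2 • b - (2 * inner ℝ b (x i)) • x i) - 2 * Δ * (∑ i, inner ℝ b (x i)) * F x = 0 := by
  set 𝓔 : (EuclideanSpace ℝ (Fin 3)) → (Fin n → (EuclideanSpace ℝ (Fin 3))) → ℝ := fun b' y =>
    fderiv ℝ F y (fun i => ‖y i‖ ^ 2 • b' - (2 * inner ℝ b' (y i)) • y i) - 2 * Δ * (∑ i, inner ℝ b' (y i)) * F y with h𝓔
  -- Z1 with the central inversion `R = −1`
  have h1 : 𝓔 (-b) (fun i => -x i) = 𝓔 b x := by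
    have h := stub_defect_rotate n F Δ (LinearIsometryEquiv.neg ℝ) (fun y => hrot _ y) b x
    simpa only [h𝓔, LinearIsometryEquiv.coe_neg] using h
  -- `−x` is the relabelled configuration
  have hcfg : (fun i => -x i) = x ∘ σ := funext fun i => by rw [comp_apply, hx i]
  -- Z2
  have h2 : 𝓔 (-b) (x ∘ σ) = 𝓔 (-b) x := by
    have h := stub_defect_perm n F Δ σ (fun y => hperm σ y) (-b) x
    simpa only [h𝓔] using h
  have h3 : 𝓔 (-b) x = -𝓔 b x := by
    simp only [h𝓔]
    exact defect_neg_left n F Δ b x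
  have h4 : 𝓔 b x = 0 := by
    rw [hcfg] at h1
    linarith [h1, h2, h3]
  simpa only [h𝓔] using h4

/-- **FREE ZEROS, II — the plane `v^⊥`.**  For a level invariant under the diagonal action of `O(3)`, the `K_v` defect vanishes at
every configuration lying in the plane through the origin perpendicular to `v` (`⟪v, xᵢ⟫ = 0` for all `i`): the reflection in `v^⊥`
fixes the configuration and reverses `v`, so `E_{−v}(x) = E_v(x)` (Z1).  Any weight; no differentiability needed.
[cite: FrancescoMathieuSenechal1997, §4.1 (4.18)–(4.19)] -/
theorem defect_eq_zero_of_orthogonal (n : ℕ) (F : (Fin n → (EuclideanSpace ℝ (Fin 3))) → ℝ) (Δ : ℝ)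
    (hrot : ∀ (R : (EuclideanSpace ℝ (Fin 3)) ≃ₗᵢ[ℝ] (EuclideanSpace ℝ (Fin 3))) (y : Fin n → (EuclideanSpace ℝ (Fin 3))), F (fun i => R (y i)) = F y)
    (v : (EuclideanSpace ℝ (Fin 3))) (x : Fin n → (EuclideanSpace ℝ (Fin 3))) (hx : ∀ i, inner ℝ v (x i) = 0) :
    fderiv ℝ F x (fun i => ‖x i‖ ^ 2 • v - (2 * inner ℝ v (x i)) • x i) - 2 * Δ * (∑ i, inner ℝ v (x i)) * F x = 0 := by
  set 𝓔 : (EuclideanSpace ℝ (Fin 3)) → (Fin n → (EuclideanSpace ℝ (Fin 3))) → ℝ := fun b' y =>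
    fderiv ℝ F y (fun i => ‖y i‖ ^ 2 • b' - (2 * inner ℝ b' (y i)) • y i) - 2 * Δ * (∑ i, inner ℝ b' (y i)) * F y with h𝓔
  -- the reflection in the plane `v^⊥`
  set R : (EuclideanSpace ℝ (Fin 3)) ≃ₗᵢ[ℝ] (EuclideanSpace ℝ (Fin 3)) := (ℝ ∙ v)ᗮ.reflection with hR
  have hRx : ∀ i, R (x i) = x i := fun i =>
    Submodule.reflection_mem_subspace_eq_self ((Submodule.mem_orthogonal_singleton_iff_inner_right).2 (hx i))
  have hRv : R v = -v := by
    rw [hR, Submodule.reflection_orthogonal_apply, Submodule.reflection_mem_subspace_eq_self (Submodule.mem_span_singleton_self v)]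
  have h1 : 𝓔 (-v) x = 𝓔 v x := by
    have h := stub_defect_rotate n F Δ R (fun y => hrot R y) v x
    simpa only [h𝓔, hRx, hRv] using h
  have h3 : 𝓔 (-v) x = -𝓔 v x := by
    simp only [h𝓔]
    exact defect_neg_left n F Δ v x
  have h4 : 𝓔 v x = 0 := by linarith [h1, h3]
  simpa only [h𝓔] using h4

/-! ## B. Ising₃ limits: translation invariance and homogeneity of the defect, and its free zeros -/

section Limit

variable {ρ : ℝ → ℝ} {Δ : ℝ} {S : CorrFamily 3}

/-- **The defect of every level of a Euclidean scale-covariant Ising₃ limit is TRANSLATION INVARIANT**: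
`E_b(S n)(x + ĉ) = E_b(S n)(x)` for `x ∈ NonCoincident` (Z4, fed by translation invariance, the Euler identity from scale covariance,
and the rotation generators Z3 from `O(3)` invariance; differentiability from real-analyticity of the limit, `analyticOnNhd_limit`).
[cite: FrancescoMathieuSenechal1997, §4.1 (4.19)] -/
theorem limit_defect_translate (hρ : ∀ δ ∈ Set.Ioc (0:ℝ) 1, 0 < ρ δ) (hlim : HasPointwiseScalingLimit (criticalCorr 3) ρ S)
    (hnorm : ∀ n z, z ∉ NonCoincident 3 n → S n z = 0) (hnd : IsNondegenerateTwoPoint S)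
    (heuc : IsEuclideanInvariant S) (hsc : IsScaleCovariant Δ S)
    {n : ℕ} {x : Fin n → (EuclideanSpace ℝ (Fin 3))} (hx : x ∈ NonCoincident 3 n) (b c : (EuclideanSpace ℝ (Fin 3))) :
    fderiv ℝ (S n) (fun i => x i + c) (fun i => ‖x i + c‖ ^ 2 • b - (2 * inner ℝ b (x i + c)) • (x i + c)) -
        2 * Δ * (∑ i, inner ℝ b (x i + c)) * S n (fun i => x i + c) =
      fderiv ℝ (S n) x (fun i => ‖x i‖ ^ 2 • b - (2 * inner ℝ b (x i)) • x i) - 2 * Δ * (∑ i, inner ℝ b (x i)) * S n x := by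
  have hdiff : DifferentiableAt ℝ (S n) x := (analyticOnNhd_limit hρ hlim hnorm hnd heuc hsc n x hx).differentiableAt
  exact stub_defect_translate n (S n) Δ x hdiff (fun v y => heuc.1 n v y)
    (fderiv_self_of_scaleCovariant n (S n) Δ x hdiff (fun t ht y => hsc n t ht y))
    (stub_fderiv_rotationGenerator n (S n) x hdiff (fun R y => heuc.2 n R y)) b c

/-- **The defect of every level of a Euclidean scale-covariant Ising₃ limit is DILATION HOMOGENEOUS of degree `1 − nΔ`** (Z5).
[cite: FrancescoMathieuSenechal1997, §4.1 (4.19)] -/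
theorem limit_defect_dilate (hρ : ∀ δ ∈ Set.Ioc (0:ℝ) 1, 0 < ρ δ) (hlim : HasPointwiseScalingLimit (criticalCorr 3) ρ S)
    (hnorm : ∀ n z, z ∉ NonCoincident 3 n → S n z = 0) (hnd : IsNondegenerateTwoPoint S)
    (heuc : IsEuclideanInvariant S) (hsc : IsScaleCovariant Δ S)
    {n : ℕ} {x : Fin n → (EuclideanSpace ℝ (Fin 3))} (hx : x ∈ NonCoincident 3 n) (b : (EuclideanSpace ℝ (Fin 3))) {t : ℝ} (ht : 0 < t) :
    fderiv ℝ (S n) (fun i => t • x i) (fun i => ‖t • x i‖ ^ 2 • b - (2 * inner ℝ b (t • x i)) • (t • x i)) -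
        2 * Δ * (∑ i, inner ℝ b (t • x i)) * S n (fun i => t • x i) =
      t ^ (1 - (n : ℝ) * Δ) *
        (fderiv ℝ (S n) x (fun i => ‖x i‖ ^ 2 • b - (2 * inner ℝ b (x i)) • x i) - 2 * Δ * (∑ i, inner ℝ b (x i)) * S n x) :=
  stub_defect_dilate n (S n) Δ x (analyticOnNhd_limit hρ hlim hnorm hnd heuc hsc n x hx).differentiableAt
    (fun t ht y => hsc n t ht y) b t ht

/-- **FREE ZEROS of the Ising₃ Ward defect, I — centrally symmetric configurations (about any centre).**  For every normalised
non-degenerate Euclidean scale-covariant limit of `criticalCorr 3`, every level `n`, every non-coincident configuration `x` that a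
relabelling `σ` maps to its point reflection about a centre `c` (`x (σ i) − c = −(x i − c)`), and EVERY generator `b`, the pointwise
`K_b` defect of `S n` vanishes at `x` — e.g. at all parallelograms (`n = 4`) and all centrally symmetric `2k`-point configurations.  No
Ward identity is assumed: this part of the conformal Ward identity is automatic. [cite: FrancescoMathieuSenechal1997, §4.3.1 (4.51)–(4.54)] -/
theorem limit_defect_eq_zero_of_centrallySymmetric (hρ : ∀ δ ∈ Set.Ioc (0:ℝ) 1, 0 < ρ δ)
    (hlim : HasPointwiseScalingLimit (criticalCorr 3) ρ S)
    (hnorm : ∀ n z, z ∉ NonCoincident 3 n → S n z = 0) (hnd : IsNondegenerateTwoPoint S)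
    (heuc : IsEuclideanInvariant S) (hsc : IsScaleCovariant Δ S)
    {n : ℕ} {x : Fin n → (EuclideanSpace ℝ (Fin 3))} (hx : x ∈ NonCoincident 3 n) (c : (EuclideanSpace ℝ (Fin 3))) (σ : Equiv.Perm (Fin n))
    (hsym : ∀ i, x (σ i) - c = -(x i - c)) (b : (EuclideanSpace ℝ (Fin 3))) :
    fderiv ℝ (S n) x (fun i => ‖x i‖ ^ 2 • b - (2 * inner ℝ b (x i)) • x i) - 2 * Δ * (∑ i, inner ℝ b (x i)) * S n x = 0 := by
  -- recentre: `y := x − ĉ` is centrally symmetric about the origin and non-coincident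
  have hyNC : (fun i => x i + -c) ∈ NonCoincident 3 n := by
    rw [mem_nonCoincident] at hx ⊢
    intro i j hij
    exact hx (add_right_cancel hij)
  have hysym : ∀ i, (fun i => x i + -c) (σ i) = -((fun i => x i + -c) i) := fun i => by
    simp only [← sub_eq_add_neg]
    exact hsym i
  have hperm := isPermutationSymmetric_of_limit hlim hnorm
  have h0 := defect_eq_zero_of_centrallySymmetric n (S n) Δ (fun R z => heuc.2 n R z) (fun τ z => hperm n τ z)
    (fun i => x i + -c) σ hysym b
  -- translate back by `c`
  have htr := limit_defect_translate hρ hlim hnorm hnd heuc hsc hyNC b c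
  simp only [neg_add_cancel_right] at htr
  rw [htr]
  exact h0

/-- **FREE ZEROS of the Ising₃ Ward defect, II — configurations in a plane perpendicular to the generator.**  For every normalised
non-degenerate Euclidean scale-covariant limit of `criticalCorr 3`, every level, every generator `v` and every non-coincident
configuration lying in SOME plane perpendicular to `v` (`⟪v, xᵢ⟫ = h` for all `i`), the pointwise `K_v` defect of `S n` vanishes at `x`.
[cite: FrancescoMathieuSenechal1997, §4.3.1 (4.51)–(4.54)] -/
theorem limit_defect_eq_zero_of_coplanar (hρ : ∀ δ ∈ Set.Ioc (0:ℝ) 1, 0 < ρ δ)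
    (hlim : HasPointwiseScalingLimit (criticalCorr 3) ρ S)
    (hnorm : ∀ n z, z ∉ NonCoincident 3 n → S n z = 0) (hnd : IsNondegenerateTwoPoint S)
    (heuc : IsEuclideanInvariant S) (hsc : IsScaleCovariant Δ S)
    {n : ℕ} {x : Fin n → (EuclideanSpace ℝ (Fin 3))} (hx : x ∈ NonCoincident 3 n) (v : (EuclideanSpace ℝ (Fin 3))) (h : ℝ) (hplane : ∀ i, inner ℝ v (x i) = h) :
    fderiv ℝ (S n) x (fun i => ‖x i‖ ^ 2 • v - (2 * inner ℝ v (x i)) • x i) - 2 * Δ * (∑ i, inner ℝ v (x i)) * S n x = 0 := by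
  by_cases hv : v = 0
  · subst hv
    have hK : (fun i : Fin n => ‖x i‖ ^ 2 • (0 : (EuclideanSpace ℝ (Fin 3))) - (2 * inner ℝ (0 : (EuclideanSpace ℝ (Fin 3))) (x i)) • x i) = 0 := by
      funext i
      simp
    rw [hK, map_zero]
    simp
  -- shift the plane through the origin: `c := (h/‖v‖²) v`, `y := x − ĉ`
  set c : (EuclideanSpace ℝ (Fin 3)) := (h / ‖v‖ ^ 2) • v with hc
  have hvc : inner ℝ v c = h := by
    have hv2 : ‖v‖ ^ 2 ≠ 0 := pow_ne_zero 2 (norm_ne_zero_iff.2 hv)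
    rw [hc, real_inner_smul_right, real_inner_self_eq_norm_sq]
    field_simp
  have hyNC : (fun i => x i + -c) ∈ NonCoincident 3 n := by
    rw [mem_nonCoincident] at hx ⊢
    intro i j hij
    exact hx (add_right_cancel hij)
  have hy0 : ∀ i, inner ℝ v ((fun i => x i + -c) i) = 0 := fun i => by
    simp only [inner_add_right, inner_neg_right, hplane i, hvc, add_neg_cancel]
  have h0 := defect_eq_zero_of_orthogonal n (S n) Δ (fun R z => heuc.2 n R z) v (fun i => x i + -c) hy0
  have htr := limit_defect_translate hρ hlim hnorm hnd heuc hsc hyNC v c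
  simp only [neg_add_cancel_right] at htr
  rw [htr]
  exact h0

/-- **The registered generator `e₀` of 7⁗: the `K_{e₀}` defect of every level of an Ising₃ limit vanishes at every non-coincident
configuration with all heights `⟪e₀, xᵢ⟫` equal** (horizontal coplanar configurations). [cite: FrancescoMathieuSenechal1997, §4.3.1 (4.51)–(4.54)] -/
theorem limit_defectK1_eq_zero_of_horizontal (hρ : ∀ δ ∈ Set.Ioc (0:ℝ) 1, 0 < ρ δ)
    (hlim : HasPointwiseScalingLimit (criticalCorr 3) ρ S)
    (hnorm : ∀ n z, z ∉ NonCoincident 3 n → S n z = 0) (hnd : IsNondegenerateTwoPoint S)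
    (heuc : IsEuclideanInvariant S) (hsc : IsScaleCovariant Δ S)
    {n : ℕ} {x : Fin n → (EuclideanSpace ℝ (Fin 3))} (hx : x ∈ NonCoincident 3 n) (h : ℝ)
    (hplane : ∀ i, inner ℝ (EuclideanSpace.single 0 1 : (EuclideanSpace ℝ (Fin 3))) (x i) = h) :
    fderiv ℝ (S n) x (fun i => ‖x i‖ ^ 2 • (EuclideanSpace.single 0 1 : (EuclideanSpace ℝ (Fin 3))) -
        (2 * inner ℝ (EuclideanSpace.single 0 1 : (EuclideanSpace ℝ (Fin 3))) (x i)) • x i) -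
      2 * Δ * (∑ i, inner ℝ (EuclideanSpace.single 0 1 : (EuclideanSpace ℝ (Fin 3))) (x i)) * S n x = 0 :=
  limit_defect_eq_zero_of_coplanar hρ hlim hnorm hnd heuc hsc hx (EuclideanSpace.single 0 1) h hplane

/-- **The order-`0` coefficient of the registered residual 7⁗_jet is FREE at horizontal configurations**: for every Ising₃ limit as
above, every level and every non-coincident configuration `x₀` with all heights equal, the `k = 0` iterated derivative of the `K_{e₀}`
defect at `x₀` vanishes.  (The conformal content of 7⁗_jet sits in the orders `k ≥ 1`, transversally to the loci of this file.)
[cite: FrancescoMathieuSenechal1997, §4.3.1 (4.51)–(4.54)] -/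
theorem limit_jetK1_order_zero_of_horizontal (hρ : ∀ δ ∈ Set.Ioc (0:ℝ) 1, 0 < ρ δ)
    (hlim : HasPointwiseScalingLimit (criticalCorr 3) ρ S)
    (hnorm : ∀ n z, z ∉ NonCoincident 3 n → S n z = 0) (hnd : IsNondegenerateTwoPoint S)
    (heuc : IsEuclideanInvariant S) (hsc : IsScaleCovariant Δ S)
    {n : ℕ} {x₀ : Fin n → (EuclideanSpace ℝ (Fin 3))} (hx₀ : x₀ ∈ NonCoincident 3 n) (h : ℝ)
    (hplane : ∀ i, inner ℝ (EuclideanSpace.single 0 1 : (EuclideanSpace ℝ (Fin 3))) (x₀ i) = h) :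
    iteratedFDeriv ℝ 0 (fun x : Fin n → (EuclideanSpace ℝ (Fin 3)) =>
      fderiv ℝ (S n) x (fun i => ‖x i‖ ^ 2 • (EuclideanSpace.single 0 1 : (EuclideanSpace ℝ (Fin 3))) -
        (2 * inner ℝ (EuclideanSpace.single 0 1 : (EuclideanSpace ℝ (Fin 3))) (x i)) • x i) -
      2 * Δ * (∑ i, inner ℝ (EuclideanSpace.single 0 1 : (EuclideanSpace ℝ (Fin 3))) (x i)) * S n x) x₀ = 0 := by
  ext m
  rw [iteratedFDeriv_zero_apply]
  exact limit_defectK1_eq_zero_of_horizontal hρ hlim hnorm hnd heuc hsc hx₀ h hplane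

/-- **Likewise at centrally symmetric configurations, for every generator.** [cite: FrancescoMathieuSenechal1997, §4.3.1 (4.51)–(4.54)] -/
theorem limit_jet_order_zero_of_centrallySymmetric (hρ : ∀ δ ∈ Set.Ioc (0:ℝ) 1, 0 < ρ δ)
    (hlim : HasPointwiseScalingLimit (criticalCorr 3) ρ S)
    (hnorm : ∀ n z, z ∉ NonCoincident 3 n → S n z = 0) (hnd : IsNondegenerateTwoPoint S)
    (heuc : IsEuclideanInvariant S) (hsc : IsScaleCovariant Δ S)
    {n : ℕ} {x₀ : Fin n → (EuclideanSpace ℝ (Fin 3))} (hx₀ : x₀ ∈ NonCoincident 3 n) (c : (EuclideanSpace ℝ (Fin 3))) (σ : Equiv.Perm (Fin n))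
    (hsym : ∀ i, x₀ (σ i) - c = -(x₀ i - c)) (b : (EuclideanSpace ℝ (Fin 3))) :
    iteratedFDeriv ℝ 0 (fun x : Fin n → (EuclideanSpace ℝ (Fin 3)) =>
      fderiv ℝ (S n) x (fun i => ‖x i‖ ^ 2 • b - (2 * inner ℝ b (x i)) • x i) - 2 * Δ * (∑ i, inner ℝ b (x i)) * S n x) x₀ = 0 := by
  ext m
  rw [iteratedFDeriv_zero_apply]
  exact limit_defect_eq_zero_of_centrallySymmetric hρ hlim hnorm hnd heuc hsc hx₀ c σ hsym b

end Limit

/-! ## Registered anchor -/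

/-- **Registered anchor of this file — the free zeros of the Ising₃ special-conformal Ward defect at centrally symmetric
configurations** (explicit-binder form of `limit_defect_eq_zero_of_centrallySymmetric`). [cite: FrancescoMathieuSenechal1997, §4.3.1 (4.51)–(4.54)] -/
theorem limit_sctDefect_eq_zero_of_centrallySymmetric : ∀ (ρ : ℝ → ℝ) (Δ : ℝ) (S : Literature.Probability.LatticeModels.CorrFamily 3), (∀ δ ∈ Set.Ioc (0:ℝ) 1, 0 < ρ δ) → Literature.Probability.LatticeModels.HasPointwiseScalingLimit (Literature.Probability.LatticeModels.criticalCorr 3) ρ S → (∀ n z, z ∉ Literature.Probability.LatticeModels.NonCoincident 3 n → S n z = 0) → Literature.Probability.LatticeModels.IsNondegenerateTwoPoint S → Literature.Probability.LatticeModels.IsEuclideanInvariant S → Literature.Probability.LatticeModels.IsScaleCovariant Δ S → ∀ (n : ℕ) (x : Fin n → EuclideanSpace ℝ (Fin 3)), x ∈ Literature.Probability.LatticeModels.NonCoincident 3 n → ∀ (c : EuclideanSpace ℝ (Fin 3)) (σ : Equiv.Perm (Fin n)), (∀ i, x (σ i) - c = -(x i - c)) → ∀ b : EuclideanSpace ℝ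 (Fin 3), fderiv ℝ (S n) x (fun i => ‖x i‖ ^ 2 • b - (2 * inner ℝ b (x i)) • x i) - 2 * Δ * (∑ i, inner ℝ b (x i)) * S n x = 0 :=
  fun _ _ _ hρ hlim hnorm hnd heuc hsc _ _ hx c σ hsym b =>
    limit_defect_eq_zero_of_centrallySymmetric hρ hlim hnorm hnd heuc hsc hx c σ hsym b

end Summit.CriticalPhenomena.Ising3DConformalLimit.MoebiusLimitExistsDefectSymmetry

end
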